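import Summits.QuantumFields.BalabanUV.Beta.FP.ResidualModeSymbolUpper
import Summits.QuantumFields.BalabanUV.Beta.FP.LatticeFormPlancherel

/-!
# `BalabanUV.Beta.FP.ResidualModePlancherel` — road «FP» (binder row D1), row H′2-IR ∕ IR-3, sub-row «IR-3-ELL-OP», file 2∕2 (THE IR-3 INSTANCE):
# **`c₀(d)·⟨φ, K_{1∕Mid} φ⟩ ≤ ⟨d^cφ, K_{Ĉ_n⁻¹} d^cφ⟩ ≤ ⟨φ, K_{1∕Mid} φ⟩`** for every finitely supported real coarse scalar `φ`, every `n ≥ 1` (`d + 1 ≥ 3`),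
# where `K_G(x) = (2π)^{−(d+1)}∫_{BZ} G e^{ip·x}` is the coarse-translation-invariant kernel of the multiplier `G` — IR3-DESIGN l.30's OPERATOR form
# `M_B ≥ c₀` (and `≤ 1`) read on `ℓ²`-finitely-supported fields, from the real-zone SYMBOL sandwich `c₀ ≤ m_{B,n}(k) ≤ 1` (files R2∕R3) by Parseval (file 1∕2)

NOT IN PRINT; OUR BOOKKEEPING (INTENT «IR-3-ELL-OP», journal l.22844).  The kernels are DEFINED by their symbols: `K_{Ĉ⁻¹, μν} := latticeKernel (p ↦ (cMat n (Re p))⁻¹ μ ν)`,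
`K_{1∕Mid} := latticeKernel (p ↦ (midSym n (Re p))⁻¹)` — that these are the two-sided `ℓ²` inverses of `Q P Qᵀ` ∕ `Q′Δ⁻²Q′ᵀ` is NOT claimed here
(leaf-06-g7's IR-2 (vi) for the former; any symbol `A` with `A·Ĉ_n = 1` on `BZ∖0`, e.g. their `GC n` up to the MEAN scaling applied on both sides, has the
same kernel integrals).  Measurability of `k ↦ Ĉ_n(k)` is read off IR-2 (i)'s zone integrability (`integrableOn_integrand_covSym_PbfSym`, `3 ≤ d+1`);
the inverse through `det`∕`adjugate` (Leibniz sums); boundedness of `Ĉ_n⁻¹` from the `l = 0` floor of IR-2 (iii) (n-dependent constants are harmless here —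
only integrability is at stake; the INEQUALITY's constant `c₀(d)` is R2's n-free one).

## What is proved (`0 sorry`; `n ≥ 1`; `3 ≤ d+1` where marked)
* §1 [folklore] `integrableOn_BZ_of_bdd`, `latticeKernel_neg`, `quad_neg`, `norm_inv_apply_le_of_floor` (`F ⪰ λ·1`, `IsUnit F.det` ⟹ `‖F⁻¹ κ λ‖ ≤ 1∕λ`).
* §2 [our object] `re_quad_cMat_ge_floor` (`λ₀(n,d)·Σ‖v‖² ≤ Re v†Ĉ_n(k)v` on `BZ∖0`, explicit `λ₀ > 0`), `norm_cMat_inv_apply_le`, `midSym_ge_floor`.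
* §3 measurability ∕ integrability on the zone: `aestronglyMeasurable_cMat_apply` (`3 ≤ d+1`), `aemeasurable_det_cMat`, `aemeasurable_cMat_inv_apply`,
  `integrableOn_cMat_inv_apply`, `integrableOn_quad_cMat_inv`, `measurable_midSym`, `integrableOn_midSym_inv`.
* §4 **`form_grad_covInv_ge`** (`c₀(d)·Σ_{x,y} φ(x)·Re K_{1∕Mid}(x−y)·φ(y) ≤ Σ_{x,y}Σ_{μν} (d^cφ)(x,μ)·Re K_{Ĉ⁻¹,μν}(x−y)·(d^cφ)(y,ν)`) and
  **`form_grad_covInv_le`** (`… ≤ Σ_{x,y} φ(x)·Re K_{1∕Mid}(x−y)·φ(y)`), for every real `φ` supported in a finite `S`, window `T ⊇ S ∪ ⋃_μ(S − e_μ)`;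
  and the PARAMETRIC forms **`form_grad_ge_of_leftInverse`** ∕ **`form_grad_le_of_leftInverse`** for ANY zone-integrable matrix multiplier `A` with
  `A(s)·Ĉ_n(s) = 1` on `BZ∖0` (the owner's interface, journal l.22907: serves leaf-06's `GC n` and `(cMat n ·)⁻¹` alike).
HONEST FRAMING: [our object] operator-level reading of the symbol sandwich for the cell's U = 1 perfect objects + [folklore] measure-theoretic bookkeeping;
0 estimates of Bałaban's manuscripts; 0∕4 row-D1 binders; NOT D1, NOT BetaPertH, NOT the continuum limit, NOT Clay.
HONEST DEPENDENCY (verbatim): «continuum YM on T⁴ ⇐ BetaPertH ∧ nine spine estimates (0/9 proved); BetaPertH ⇐ (D1) ∧ (D4) ∧ CAP+tail; G-an2-4 gates asym, D1 and NE2/3/4.»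
ABSOLUTE RULE respected: no cited fact, no `def`, no `def … : Prop`, nothing of the manuscripts asserted.
Provenance: D1 formalisation swarm leaf prover 02, gen 7 (prover-b2b-balaban-beta-d1-formalise-leaf-02-g7-0), road-FP «IR-3-ELL-OP» (journal l.22844), 2026-08-20.
-/

noncomputable section

open Complex Finset Matrix MeasureTheory
open scoped Real BigOperators ComplexConjugate
open Literature.MathematicalPhysics.QuantumFieldTheory.Balaban1983to89
open B4Strip (ofRealVec reVec)
open B4ContourShift (BZ integrand latticeKernel)
open B5Prop11Fiber (d1Sym norm_d1Sym_le_two)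
open B6QGQLower276 (X e)
open B5Momentum166Zd (FT isCompact_BZ measurableSet_BZ volume_BZ_lt_top)
open Summit.QuantumFields.BalabanUV.Beta.GAN24.FibreSymbols (gsum)
open Summit.QuantumFields.BalabanUV.Beta.GAN24.AliasTiling (apt)
open Summit.QuantumFields.BalabanUV.Beta.GAN24.PushSumSymbol (cweight)
open Summit.QuantumFields.BalabanUV.Beta.FP.PerfectPropagatorSymbol (quad PinfSym quad_eq_dotProduct)
open Summit.QuantumFields.BalabanUV.Beta.FP.PerfectPropagatorBound (sum_norm_sq_pos d1Sym_ne_zero continuous_d1Sym)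
open Summit.QuantumFields.BalabanUV.Beta.FP.CoarseCovarianceAlias (covSym)
open Summit.QuantumFields.BalabanUV.Beta.FP.CoarseCovarianceAliasBF (wrapPt wrapPt_mem_BZ PbfSym reVec_ofRealVec integrableOn_integrand_covSym_PbfSym)
open Summit.QuantumFields.BalabanUV.Beta.FP.CoarseCovarianceElliptic (re_quad_PinfSym_ge)
open Summit.QuantumFields.BalabanUV.Beta.FP.CoarseCovarianceEllipticBound (re_quad_covSym_PbfSym_ge_alias norm_cweight_apt_zero_ge)
open Summit.QuantumFields.BalabanUV.Beta.FP.ResidualModeSymbols (norm_prod_gsum_apt_zero_ge)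
open Summit.QuantumFields.BalabanUV.Beta.FP.ResidualModeSymbolBound (cMat bweight lapD midSym mB quad_cMat isUnit_cMat_det d1Sym_wrapPt
  wrapPt_apt_ne_zero d1Sym_wrapPt_apt_ne_zero lapD_apt_pos midSym_pos)
open Summit.QuantumFields.BalabanUV.Beta.FP.ResidualModeAliasBound (mB_ge_const aEll_pos lapD_le)
open Summit.QuantumFields.BalabanUV.Beta.FP.ResidualModeSymbolUpper (mB_le_one)
open Summit.QuantumFields.BalabanUV.Beta.FP.LatticeFormPlancherel (form_diff_ge_of_symbol)
open Summit.QuantumFields.BalabanUV.Beta.FP.PerfectMaxwellDict (latticeKernel_const_mul)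

namespace Summit.QuantumFields.BalabanUV.Beta.FP.ResidualModePlancherel

variable {d : ℕ}

/-! ## §1 Generic letters -/

/-- [folklore] A bounded a.e.-strongly-measurable function on the zone is integrable there. -/
theorem integrableOn_BZ_of_bdd {f : (Fin (d + 1) → ℝ) → ℂ} (hf : AEStronglyMeasurable f (volume.restrict (BZ (d + 1)))) {C : ℝ}
    (hC : ∀ᵐ s ∂(volume.restrict (BZ (d + 1))), ‖f s‖ ≤ C) : IntegrableOn f (BZ (d + 1)) :=
  ⟨hf, HasFiniteIntegral.restrict_of_bounded (C := C) volume_BZ_lt_top hC⟩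

/-- [folklore] `K_{−G} = −K_G`. -/
theorem latticeKernel_neg (G : (Fin (d + 1) → ℂ) → ℂ) (x : Fin (d + 1) → ℤ) : latticeKernel (fun p => -G p) x = -latticeKernel G x := by
  have h := latticeKernel_const_mul (-1) G x
  simp only [neg_mul, one_mul] at h
  exact h

/-- [folklore] `quad (−M) v = −quad M v`. -/
theorem quad_neg {ι : ℕ} (M : Matrix (Fin ι) (Fin ι) ℂ) (v : Fin ι → ℂ) : quad (-M) v = -quad M v := by
  unfold quad
  simp only [Matrix.neg_apply, mul_neg, neg_mul, Finset.sum_neg_distrib]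

/-- [folklore] **A COERCIVE MATRIX HAS A BOUNDED INVERSE, ENTRYWISE**: `IsUnit F.det`, `0 < λ`, `λ·Σ‖w‖² ≤ Re w†Fw` for all `w` ⟹ `‖F⁻¹ κ l‖ ≤ 1∕λ`
(at `w := F⁻¹e_l`: `λ‖w‖² ≤ Re w†e_l ≤ ‖w_l‖ ≤ ‖w‖`). -/
theorem norm_inv_apply_le_of_floor {ι : ℕ} {F : Matrix (Fin ι) (Fin ι) ℂ} (hdet : IsUnit F.det) {lam : ℝ} (hlam : 0 < lam)
    (hfloor : ∀ w : Fin ι → ℂ, lam * ∑ i, ‖w i‖ ^ 2 ≤ (star w ⬝ᵥ (F *ᵥ w)).re) (κ l : Fin ι) : ‖F⁻¹ κ l‖ ≤ 1 / lam := by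
  set w : Fin ι → ℂ := F⁻¹ *ᵥ Pi.single l 1 with hw
  have hwκ : w κ = F⁻¹ κ l := by rw [hw, Matrix.mulVec_single_one]; rfl
  have hFw : F *ᵥ w = Pi.single l 1 := by rw [hw, mulVec_mulVec, Matrix.mul_nonsing_inv _ hdet, one_mulVec]
  have h1 := hfloor w
  rw [hFw, dotProduct_single, mul_one, Pi.star_apply, Complex.star_def, Complex.conj_re] at h1
  set S : ℝ := ∑ i, ‖w i‖ ^ 2 with hS
  have hS0 : 0 ≤ S := by positivity
  have hl : ‖w l‖ ^ 2 ≤ S := Finset.single_le_sum (f := fun i => ‖w i‖ ^ 2) (fun i _ => by positivity) (Finset.mem_univ l)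
  have hk : ‖w κ‖ ^ 2 ≤ S := Finset.single_le_sum (f := fun i => ‖w i‖ ^ 2) (fun i _ => by positivity) (Finset.mem_univ κ)
  have h2 : lam * S ≤ ‖w l‖ := h1.trans (Complex.re_le_norm _)
  rw [← hwκ]
  -- `lam² S² ≤ ‖w_l‖² ≤ S` ⟹ `lam² S ≤ 1` ⟹ `‖w_κ‖² ≤ S ≤ 1/lam²`
  have h3 : (lam * S) ^ 2 ≤ S := (pow_le_pow_left₀ (mul_nonneg hlam.le hS0) h2 2).trans hl
  have h4 : ‖w κ‖ ^ 2 ≤ (1 / lam) ^ 2 := by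
    by_cases hSz : S = 0
    · have : ‖w κ‖ ^ 2 ≤ 0 := hSz ▸ hk
      exact this.trans (by positivity)
    · have hSpos : 0 < S := lt_of_le_of_ne hS0 (Ne.symm hSz)
      have h5 : lam ^ 2 * S ≤ 1 := by
        have : lam ^ 2 * S * S ≤ 1 * S := by nlinarith
        exact le_of_mul_le_mul_right this hSpos
      calc ‖w κ‖ ^ 2 ≤ S := hk
        _ ≤ (1 / lam) ^ 2 := by rw [div_pow, one_pow, le_div_iff₀ (by positivity)]; nlinarith
  exact (pow_le_pow_iff_left₀ (norm_nonneg _) (by positivity) two_ne_zero).1 h4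

/-! ## §2 The floors of `Ĉ_n` and `Mid` on the punctured zone -/

section Floors

variable (n : ℕ) [NeZero n]

/-- [our object] **THE `l = 0` FLOOR OF `Ĉ_n(k)`, UNIFORM ON THE PUNCTURED ZONE** (IR-2 (iii) in form currency, crude): for `k ∈ BZ`, `k ≠ 0` and every `v`,
`λ₀·Σ‖v‖² ≤ Re v†Ĉ_n(k)v`, `λ₀ = (n^{d+1})⁻¹·(2n∕π)^{2d+4} ∕ ((π²∕4)^{2d+6}·4(d+1))`. -/
theorem re_quad_cMat_ge_floor {k : Fin (d + 1) → ℝ} (hk : k ∈ BZ (d + 1)) (hk0 : k ≠ 0) (v : Fin (d + 1) → ℂ) :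
    ((n : ℝ) ^ (d + 1))⁻¹ * (((2 / Real.pi * n) ^ (d + 2)) ^ 2 / ((Real.pi ^ 2 / 4) ^ (2 * (d + 1) + 4) * (4 * ((d : ℝ) + 1))))
      * ∑ i, ‖v i‖ ^ 2 ≤ (quad (cMat n k) v).re := by
  have hn0 : (0 : ℝ) < n := by exact_mod_cast Nat.pos_of_ne_zero (NeZero.ne n)
  set a0 : Fin (d + 1) → Fin n := fun _ => 0 with ha0
  have hext := re_quad_covSym_PbfSym_ge_alias n k v a0
  have hquad : (∑ κ, ∑ l, conj (v κ) * covSym n κ l (PbfSym κ l) (ofRealVec k) * v l).re = (quad (cMat n k) v).re := rfl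
  rw [hquad] at hext
  refine le_trans ?_ hext
  set s' := wrapPt (apt n a0 k) with hs'
  set u : Fin (d + 1) → ℂ := fun l => conj (cweight n l (ofRealVec (apt n a0 k))) * v l with hu
  have hs'BZ : s' ∈ BZ (d + 1) := wrapPt_mem_BZ _
  have hs'0 : s' ≠ 0 := wrapPt_apt_ne_zero n hk hk0 a0
  have hph0 : d1Sym s' ≠ 0 := d1Sym_ne_zero hs'BZ hs'0
  have hP := re_quad_PinfSym_ge hs'BZ hs'0 hph0 u
  -- `Σ‖u‖² ≥ (2n/π)^{2(d+2)}·Σ‖v‖²` and `Σ‖d1Sym s'‖² = lapD (apt n a0 k) ≤ 4(d+1)`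
  have hu2 : ((2 / Real.pi * n) ^ (d + 2)) ^ 2 * ∑ i, ‖v i‖ ^ 2 ≤ ∑ i, ‖u i‖ ^ 2 := by
    rw [Finset.mul_sum]
    refine Finset.sum_le_sum fun l _ => ?_
    rw [hu]
    simp only [norm_mul, Complex.norm_conj]
    rw [mul_pow (‖cweight n l (ofRealVec (apt n a0 k))‖) (‖v l‖) 2]
    exact mul_le_mul_of_nonneg_right (pow_le_pow_left₀ (by positivity) (norm_cweight_apt_zero_ge n hk l) 2) (by positivity)
  have hlap : ∑ μ, ‖d1Sym s' μ‖ ^ 2 ≤ 4 * ((d : ℝ) + 1) := by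
    have : ∑ μ, ‖d1Sym s' μ‖ ^ 2 = lapD (apt n a0 k) := by rw [hs', d1Sym_wrapPt]; rfl
    rw [this]; exact lapD_le _
  have hlap0 : 0 < ∑ μ, ‖d1Sym s' μ‖ ^ 2 := sum_norm_sq_pos hph0
  have hγ : (0 : ℝ) < (Real.pi ^ 2 / 4) ^ (2 * (d + 1) + 4) := by positivity
  calc ((n : ℝ) ^ (d + 1))⁻¹ * (((2 / Real.pi * n) ^ (d + 2)) ^ 2 / ((Real.pi ^ 2 / 4) ^ (2 * (d + 1) + 4) * (4 * ((d : ℝ) + 1))))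
        * ∑ i, ‖v i‖ ^ 2
      = ((n : ℝ) ^ (d + 1))⁻¹ * ((((2 / Real.pi * n) ^ (d + 2)) ^ 2 * ∑ i, ‖v i‖ ^ 2)
          / ((Real.pi ^ 2 / 4) ^ (2 * (d + 1) + 4) * (4 * ((d : ℝ) + 1)))) := by ring
    _ ≤ ((n : ℝ) ^ (d + 1))⁻¹ * ((∑ i, ‖u i‖ ^ 2) / ((Real.pi ^ 2 / 4) ^ (2 * (d + 1) + 4) * ∑ μ, ‖d1Sym s' μ‖ ^ 2)) := by
        refine mul_le_mul_of_nonneg_left ?_ (by positivity)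
        exact div_le_div₀ (by positivity) hu2 (by positivity) (mul_le_mul_of_nonneg_left hlap hγ.le)
    _ ≤ ((n : ℝ) ^ (d + 1))⁻¹ * (quad (PinfSym s' (d1Sym s')) u).re := mul_le_mul_of_nonneg_left hP (by positivity)

/-- [our object] **`Ĉ_n(k)⁻¹` IS ENTRYWISE BOUNDED ON THE PUNCTURED ZONE, UNIFORMLY IN `k`**: `‖(cMat n k)⁻¹ κ l‖ ≤ 1∕λ₀(n,d)`. -/
theorem norm_cMat_inv_apply_le {k : Fin (d + 1) → ℝ} (hk : k ∈ BZ (d + 1)) (hk0 : k ≠ 0) (κ l : Fin (d + 1)) :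
    ‖(cMat n k)⁻¹ κ l‖ ≤ 1 / (((n : ℝ) ^ (d + 1))⁻¹ * (((2 / Real.pi * n) ^ (d + 2)) ^ 2
      / ((Real.pi ^ 2 / 4) ^ (2 * (d + 1) + 4) * (4 * ((d : ℝ) + 1))))) := by
  have hn0 : (0 : ℝ) < n := by exact_mod_cast Nat.pos_of_ne_zero (NeZero.ne n)
  refine norm_inv_apply_le_of_floor (isUnit_cMat_det n hk hk0) (by positivity) (fun w => ?_) κ l
  have h := re_quad_cMat_ge_floor n hk hk0 w
  rwa [quad_eq_dotProduct] at h

/-- [our object] **THE FLOOR OF `Mid`**: for `k ∈ BZ`, `k ≠ 0`, `(n^{d+1})⁻¹·(2n∕π)^{2(d+1)} ∕ (4(d+1))² ≤ midSym n k` (the `a = 0` term). -/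
theorem midSym_ge_floor {k : Fin (d + 1) → ℝ} (hk : k ∈ BZ (d + 1)) (hk0 : k ≠ 0) :
    ((n : ℝ) ^ (d + 1))⁻¹ * ((2 / Real.pi * n) ^ (2 * (d + 1)) / (4 * ((d : ℝ) + 1)) ^ 2) ≤ midSym n k := by
  have hn0 : (0 : ℝ) < n := by exact_mod_cast Nat.pos_of_ne_zero (NeZero.ne n)
  unfold midSym
  refine mul_le_mul_of_nonneg_left ?_ (by positivity)
  refine le_trans ?_ (Finset.single_le_sum (f := fun a : Fin (d + 1) → Fin n =>
      ‖bweight n (ofRealVec (apt n a k))‖ ^ 2 / lapD (apt n a k) ^ 2) (fun a _ => by unfold lapD; positivity) (Finset.mem_univ (fun _ => (0 : Fin n))))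
  have hbw : (2 / Real.pi * n) ^ (2 * (d + 1)) ≤ ‖bweight n (ofRealVec (apt n (fun _ => (0 : Fin n)) k))‖ ^ 2 := by
    rw [pow_mul']
    exact pow_le_pow_left₀ (by positivity) (norm_prod_gsum_apt_zero_ge n hk) 2
  have hl := lapD_le (apt n (fun _ => (0 : Fin n)) k)
  have hl0 := lapD_apt_pos n hk hk0 (fun _ => (0 : Fin n))
  exact div_le_div₀ (by positivity) hbw (by positivity) (pow_le_pow_left₀ hl0.le hl 2)

end Floors

/-! ## §3 Measurability and integrability of the symbols on the zone -/

section Measurability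

variable (n : ℕ) [NeZero n]

/-- [our object] The entries of `k ↦ Ĉ_n(k)` are a.e.-strongly measurable on the zone (read off IR-2 (i)'s integrability at lattice site `0`). -/
theorem aestronglyMeasurable_cMat_apply (hd : 3 ≤ d + 1) (κ l : Fin (d + 1)) :
    AEStronglyMeasurable (fun s : Fin (d + 1) → ℝ => cMat n s κ l) (volume.restrict (BZ (d + 1))) := by
  have h := (integrableOn_integrand_covSym_PbfSym hd n κ l 0).aestronglyMeasurable
  refine h.congr (Filter.Eventually.of_forall fun s => ?_)
  simp [integrand, cMat, B4ContourShift.phase]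

/-- [our object] The entries as a.e.-measurable functions. -/
theorem aemeasurable_cMat_apply (hd : 3 ≤ d + 1) (κ l : Fin (d + 1)) :
    AEMeasurable (fun s : Fin (d + 1) → ℝ => cMat n s κ l) (volume.restrict (BZ (d + 1))) :=
  (aestronglyMeasurable_cMat_apply n hd κ l).aemeasurable

/-- [folklore] `det` of an a.e.-measurable matrix field is a.e.-measurable (Leibniz sum). -/
theorem aemeasurable_det_of_apply {ι : ℕ} {μ : Measure (Fin (d + 1) → ℝ)} {M : (Fin (d + 1) → ℝ) → Matrix (Fin ι) (Fin ι) ℂ}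
    (hM : ∀ i j, AEMeasurable (fun s => M s i j) μ) : AEMeasurable (fun s => (M s).det) μ := by
  simp_rw [Matrix.det_apply']
  refine Finset.aemeasurable_fun_sum _ fun σ _ => ?_
  refine AEMeasurable.const_mul ?_ _
  exact Finset.aemeasurable_fun_prod _ fun i _ => hM (σ i) i

/-- [folklore] The inverse of an a.e.-measurable matrix field is entrywise a.e.-measurable (`M⁻¹ = det⁻¹ • adjugate`, adjugate entries are determinants). -/
theorem aemeasurable_inv_apply_of_apply {ι : ℕ} {μ : Measure (Fin (d + 1) → ℝ)} {M : (Fin (d + 1) → ℝ) → Matrix (Fin ι) (Fin ι) ℂ}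
    (hM : ∀ i j, AEMeasurable (fun s => M s i j) μ) (κ l : Fin ι) : AEMeasurable (fun s => (M s)⁻¹ κ l) μ := by
  have hadj : AEMeasurable (fun s => (M s).adjugate κ l) μ := by
    simp_rw [Matrix.adjugate_apply]
    refine aemeasurable_det_of_apply fun i j => ?_
    simp_rw [Matrix.updateRow_apply]
    by_cases h : i = l
    · simp only [h, if_true]; exact aemeasurable_const
    · simp only [h, if_false]; exact hM i j
  have hdet := aemeasurable_det_of_apply hM
  have he : (fun s => (M s)⁻¹ κ l) = fun s => ((M s).det)⁻¹ * (M s).adjugate κ l := by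
    funext s
    rw [Matrix.inv_def, Ring.inverse_eq_inv, Matrix.smul_apply, smul_eq_mul]
  rw [he]
  exact hdet.inv.mul hadj

/-- [our object] The entries of `k ↦ Ĉ_n(k)⁻¹` are a.e.-measurable on the zone. -/
theorem aemeasurable_cMat_inv_apply (hd : 3 ≤ d + 1) (κ l : Fin (d + 1)) :
    AEMeasurable (fun s : Fin (d + 1) → ℝ => (cMat n s)⁻¹ κ l) (volume.restrict (BZ (d + 1))) :=
  aemeasurable_inv_apply_of_apply (aemeasurable_cMat_apply n hd) κ l

/-- [folklore] Off the null set `{0}`, every point of the restricted zone measure is a punctured-zone point. -/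
theorem ae_mem_BZ_ne_zero : ∀ᵐ s ∂(volume.restrict (BZ (d + 1))), s ∈ BZ (d + 1) ∧ s ≠ 0 := by
  have h0 : ∀ᵐ s ∂(volume.restrict (BZ (d + 1))), s ≠ (0 : Fin (d + 1) → ℝ) := by
    have : (volume.restrict (BZ (d + 1))) {(0 : Fin (d + 1) → ℝ)} = 0 := by
      rw [Measure.restrict_apply (measurableSet_singleton _)]
      exact measure_mono_null Set.inter_subset_left (measure_singleton _)
    filter_upwards [compl_mem_ae_iff.2 this] with s hs
    simpa using hs
  filter_upwards [h0, ae_restrict_mem (measurableSet_BZ (d := d + 1))] with s h1 h2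
  exact ⟨h2, h1⟩

/-- [our object] The entries of `Ĉ_n⁻¹` are integrable on the zone. -/
theorem integrableOn_cMat_inv_apply (hd : 3 ≤ d + 1) (κ l : Fin (d + 1)) :
    IntegrableOn (fun s : Fin (d + 1) → ℝ => (cMat n s)⁻¹ κ l) (BZ (d + 1)) := by
  refine integrableOn_BZ_of_bdd (aemeasurable_cMat_inv_apply n hd κ l).aestronglyMeasurable
    (C := 1 / (((n : ℝ) ^ (d + 1))⁻¹ * (((2 / Real.pi * n) ^ (d + 2)) ^ 2
      / ((Real.pi ^ 2 / 4) ^ (2 * (d + 1) + 4) * (4 * ((d : ℝ) + 1)))))) ?_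
  filter_upwards [ae_mem_BZ_ne_zero (d := d)] with s hs
  exact norm_cMat_inv_apply_le n hs.1 hs.2 κ l

/-- [our object] `k ↦ d̂^c(k)†Ĉ_n(k)⁻¹d̂^c(k)` is integrable on the zone. -/
theorem integrableOn_quad_cMat_inv (hd : 3 ≤ d + 1) :
    IntegrableOn (fun s : Fin (d + 1) → ℝ => quad (cMat n s)⁻¹ (d1Sym s)) (BZ (d + 1)) := by
  have hd1 : ∀ α, Continuous fun s : Fin (d + 1) → ℝ => d1Sym s α := fun α => (continuous_apply α).comp continuous_d1Sym
  have hmeas : AEMeasurable (fun s : Fin (d + 1) → ℝ => quad (cMat n s)⁻¹ (d1Sym s)) (volume.restrict (BZ (d + 1))) := by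
    unfold quad
    refine Finset.aemeasurable_fun_sum _ fun α _ => Finset.aemeasurable_fun_sum _ fun β _ => ?_
    exact (((Complex.continuous_conj.comp (hd1 α)).aemeasurable).mul (aemeasurable_cMat_inv_apply n hd α β)).mul (hd1 β).aemeasurable
  refine integrableOn_BZ_of_bdd hmeas.aestronglyMeasurable
    (C := ∑ _α : Fin (d + 1), ∑ _β : Fin (d + 1), 2 * (1 / (((n : ℝ) ^ (d + 1))⁻¹ * (((2 / Real.pi * n) ^ (d + 2)) ^ 2
      / ((Real.pi ^ 2 / 4) ^ (2 * (d + 1) + 4) * (4 * ((d : ℝ) + 1)))))) * 2) ?_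
  filter_upwards [ae_mem_BZ_ne_zero (d := d)] with s hs
  unfold quad
  refine (norm_sum_le _ _).trans (Finset.sum_le_sum fun α _ => (norm_sum_le _ _).trans (Finset.sum_le_sum fun β _ => ?_))
  rw [norm_mul, norm_mul, Complex.norm_conj]
  have h1 := norm_d1Sym_le_two s α
  have h2 := norm_d1Sym_le_two s β
  have h3 := norm_cMat_inv_apply_le n hs.1 hs.2 α β
  have h4 : 0 ≤ ‖(cMat n s)⁻¹ α β‖ := norm_nonneg _
  gcongr

omit [NeZero n] in
/-- [our object] `midSym n` is measurable (continuous pieces, one division). -/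
theorem measurable_midSym : Measurable (midSym (d := d) n) := by
  have hapt : ∀ a : Fin (d + 1) → Fin n, Continuous fun s : Fin (d + 1) → ℝ => apt n a s := fun a =>
    continuous_pi fun i => ((continuous_apply i).add continuous_const).div_const _
  have hbw : ∀ a : Fin (d + 1) → Fin n, Continuous fun s : Fin (d + 1) → ℝ => ‖bweight n (ofRealVec (apt n a s))‖ ^ 2 := by
    intro a
    refine (Continuous.norm ?_).pow 2
    unfold bweight gsum
    refine continuous_finsetProd _ fun i _ => continuous_finsetSum _ fun t _ => Complex.continuous_exp.comp ?_
    refine (continuous_const.mul ?_).mul continuous_const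
    exact Complex.continuous_ofReal.comp ((continuous_apply i).comp (hapt a))
  have hlap : ∀ a : Fin (d + 1) → Fin n, Continuous fun s : Fin (d + 1) → ℝ => lapD (apt n a s) ^ 2 := by
    intro a
    unfold lapD
    refine (continuous_finsetSum _ fun ν _ => ((continuous_apply ν).comp (continuous_d1Sym.comp (hapt a))).norm.pow 2).pow 2
  unfold midSym
  exact (Finset.measurable_sum _ fun a _ => (hbw a).measurable.div (hlap a).measurable).const_mul _

/-- [our object] `k ↦ (midSym n k)⁻¹` is integrable on the zone (bounded by the inverse floor off `k = 0`). -/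
theorem integrableOn_midSym_inv :
    IntegrableOn (fun s : Fin (d + 1) → ℝ => (((midSym n s)⁻¹ : ℝ) : ℂ)) (BZ (d + 1)) := by
  have hn0 : (0 : ℝ) < n := by exact_mod_cast Nat.pos_of_ne_zero (NeZero.ne n)
  have hmeas : AEStronglyMeasurable (fun s : Fin (d + 1) → ℝ => (((midSym n s)⁻¹ : ℝ) : ℂ)) (volume.restrict (BZ (d + 1))) :=
    (Complex.continuous_ofReal.measurable.comp (measurable_midSym n).inv).aestronglyMeasurable
  refine integrableOn_BZ_of_bdd hmeas (C := 1 / (((n : ℝ) ^ (d + 1))⁻¹ * ((2 / Real.pi * n) ^ (2 * (d + 1)) / (4 * ((d : ℝ) + 1)) ^ 2))) ?_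
  filter_upwards [ae_mem_BZ_ne_zero (d := d)] with s hs
  have hm := midSym_pos n hs.1 hs.2
  have hfl := midSym_ge_floor n hs.1 hs.2
  rw [Complex.norm_real, Real.norm_eq_abs, abs_of_pos (inv_pos.2 hm), inv_eq_one_div]
  exact one_div_le_one_div_of_le (by positivity) hfl

end Measurability

/-! ## §4 The operator inequalities -/

section Operator

variable (n : ℕ) [NeZero n]

/-- [our object] **THE PARAMETRIC FORM (symbol `A` as a letter)** — for ANY matrix multiplier `A` with zone-integrable entries that is a LEFT INVERSE of
`Ĉ_n` on the punctured real zone (`A(s)·Ĉ_n(s) = 1`, `s ∈ BZ∖0`; e.g. leaf-06's strip-regular `GC n` up to the MEAN scaling, or `(cMat n ·)⁻¹`):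
`c₀(d) · Σ_{x,y} φ(x)·Re K_{1∕Mid}(x−y)·φ(y) ≤ Σ_{x,y} Σ_{μν} (d^cφ)(x,μ)·Re K_{A_{μν}}(x−y)·(d^cφ)(y,ν)`. -/
theorem form_grad_ge_of_leftInverse (hd : 3 ≤ d + 1) {A : (Fin (d + 1) → ℂ) → Matrix (Fin (d + 1)) (Fin (d + 1)) ℂ}
    (hAint : ∀ α β, IntegrableOn (fun p => A (ofRealVec p) α β) (BZ (d + 1)))
    (hAinv : ∀ s ∈ BZ (d + 1), s ≠ 0 → A (ofRealVec s) * cMat n s = 1)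
    {S T : Finset (X (d + 1))} {φ : X (d + 1) → ℝ} (hS : ∀ y ∉ S, φ y = 0) (hST : S ⊆ T) (hTe : ∀ μ, ∀ y ∈ S, y - e μ ∈ T) :
    (4 / Real.pi ^ 2) ^ (d + 1 + 2) / (Real.pi ^ 2 / 4 + ((d : ℝ) + 1) * ((5 : ℝ) ^ (d + 1) - 1) * (Real.pi ^ 4 / 16) * (Real.pi / 2) ^ (2 * (d + 1)))
      * ∑ x ∈ T, ∑ y ∈ T, φ x * (latticeKernel (fun p => (((midSym n (reVec p))⁻¹ : ℝ) : ℂ)) (x - y)).re * φ y ≤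
      ∑ x ∈ T, ∑ y ∈ T, ∑ μ, ∑ ν, (φ (x + e μ) - φ x) * (latticeKernel (fun p => A p μ ν) (x - y)).re * (φ (y + e ν) - φ y) := by
  have hAeq : ∀ s ∈ BZ (d + 1), s ≠ 0 → A (ofRealVec s) = (cMat n s)⁻¹ := fun s hs hs0 =>
    (Matrix.inv_eq_left_inv (hAinv s hs hs0)).symm
  refine form_diff_ge_of_symbol hS hST hTe (A := A) (b := fun p => (((midSym n (reVec p))⁻¹ : ℝ) : ℂ)) hAint ?_ ?_ (fun s hs hs0 => ?_)
  · refine (integrableOn_quad_cMat_inv n hd).congr_fun_ae ?_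
    filter_upwards [ae_mem_BZ_ne_zero (d := d)] with s hs
    rw [hAeq s hs.1 hs.2]
  · simp only [reVec_ofRealVec]; exact integrableOn_midSym_inv n
  · rw [hAeq s hs hs0]
    simp only [reVec_ofRealVec, Complex.ofReal_re]
    have hm := midSym_pos n hs hs0
    have h := mB_ge_const n hs hs0
    unfold mB at h
    rw [← div_le_iff₀' hm] at h
    simpa [div_eq_mul_inv] using h

/-- [our object] THE PARAMETRIC FORM, UPPER: same `A`, `Σ_{x,y} Σ_{μν} (d^cφ)(x,μ)·Re K_{A_{μν}}(x−y)·(d^cφ)(y,ν) ≤ Σ_{x,y} φ(x)·Re K_{1∕Mid}(x−y)·φ(y)`. -/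
theorem form_grad_le_of_leftInverse (hd : 3 ≤ d + 1) {A : (Fin (d + 1) → ℂ) → Matrix (Fin (d + 1)) (Fin (d + 1)) ℂ}
    (hAint : ∀ α β, IntegrableOn (fun p => A (ofRealVec p) α β) (BZ (d + 1)))
    (hAinv : ∀ s ∈ BZ (d + 1), s ≠ 0 → A (ofRealVec s) * cMat n s = 1)
    {S T : Finset (X (d + 1))} {φ : X (d + 1) → ℝ} (hS : ∀ y ∉ S, φ y = 0) (hST : S ⊆ T) (hTe : ∀ μ, ∀ y ∈ S, y - e μ ∈ T) :
    ∑ x ∈ T, ∑ y ∈ T, ∑ μ, ∑ ν, (φ (x + e μ) - φ x) * (latticeKernel (fun p => A p μ ν) (x - y)).re * (φ (y + e ν) - φ y) ≤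
      ∑ x ∈ T, ∑ y ∈ T, φ x * (latticeKernel (fun p => (((midSym n (reVec p))⁻¹ : ℝ) : ℂ)) (x - y)).re * φ y := by
  have hAeq : ∀ s ∈ BZ (d + 1), s ≠ 0 → A (ofRealVec s) = (cMat n s)⁻¹ := fun s hs hs0 =>
    (Matrix.inv_eq_left_inv (hAinv s hs hs0)).symm
  have h := form_diff_ge_of_symbol hS hST hTe (A := fun p => -A p) (b := fun p => -(((midSym n (reVec p))⁻¹ : ℝ) : ℂ))
    (c := 1) (fun α β => ?_) ?_ ?_ (fun s hs hs0 => ?_)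
  · have hA : ∀ μ ν (z : X (d + 1)), latticeKernel (fun p => (-A p) μ ν) z = -latticeKernel (fun p => A p μ ν) z := by
      intro μ ν z
      rw [← latticeKernel_neg]
      rfl
    simp only [hA, latticeKernel_neg, Complex.neg_re, mul_neg, neg_mul, Finset.sum_neg_distrib, one_mul] at h
    linarith
  · simp only [Matrix.neg_apply]; exact (hAint α β).neg
  · simp only [quad_neg]
    refine (integrableOn_quad_cMat_inv n hd).neg.congr_fun_ae ?_
    filter_upwards [ae_mem_BZ_ne_zero (d := d)] with s hs
    simp only [Pi.neg_apply, hAeq s hs.1 hs.2]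
  · simp only [reVec_ofRealVec]; exact (integrableOn_midSym_inv n).neg
  · rw [quad_neg, hAeq s hs hs0]
    simp only [reVec_ofRealVec, Complex.neg_re, Complex.ofReal_re, one_mul, neg_le_neg_iff]
    have hm := midSym_pos n hs hs0
    have h := mB_le_one n hs hs0
    unfold mB at h
    rw [← le_div_iff₀' hm] at h
    simpa [div_eq_mul_inv] using h

/-- [our object] **IR-3-ELL AT OPERATOR LEVEL, LOWER** (the instance `A := Ĉ_n⁻¹`): for `3 ≤ d+1`, every `n ≥ 1`, every real coarse scalar `φ` supported
in a finite `S`, window `T ⊇ S` with `S − e_μ ⊆ T`: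
`c₀(d) · Σ_{x,y∈T} φ(x)·Re K_{1∕Mid}(x−y)·φ(y) ≤ Σ_{x,y∈T} Σ_{μν} (φ(x+e_μ) − φ(x))·Re K_{Ĉ_n⁻¹,μν}(x−y)·(φ(y+e_ν) − φ(y))`,
`c₀(d) = (4∕π²)^{d+3} ∕ aEll d` n-FREE (R2's constant) — `⟨d^cφ, K_{Ĉ⁻¹} d^cφ⟩ ≥ c₀ ⟨φ, K_{1∕Mid} φ⟩`. -/
theorem form_grad_covInv_ge (hd : 3 ≤ d + 1) {S T : Finset (X (d + 1))} {φ : X (d + 1) → ℝ} (hS : ∀ y ∉ S, φ y = 0) (hST : S ⊆ T)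
    (hTe : ∀ μ, ∀ y ∈ S, y - e μ ∈ T) :
    (4 / Real.pi ^ 2) ^ (d + 1 + 2) / (Real.pi ^ 2 / 4 + ((d : ℝ) + 1) * ((5 : ℝ) ^ (d + 1) - 1) * (Real.pi ^ 4 / 16) * (Real.pi / 2) ^ (2 * (d + 1)))
      * ∑ x ∈ T, ∑ y ∈ T, φ x * (latticeKernel (fun p => (((midSym n (reVec p))⁻¹ : ℝ) : ℂ)) (x - y)).re * φ y ≤
      ∑ x ∈ T, ∑ y ∈ T, ∑ μ, ∑ ν, (φ (x + e μ) - φ x) * (latticeKernel (fun p => (cMat n (reVec p))⁻¹ μ ν) (x - y)).re * (φ (y + e ν) - φ y) :=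
  form_grad_ge_of_leftInverse n hd (A := fun p => (cMat n (reVec p))⁻¹)
    (fun α β => by simp only [reVec_ofRealVec]; exact integrableOn_cMat_inv_apply n hd α β)
    (fun s hs hs0 => by rw [reVec_ofRealVec]; exact Matrix.nonsing_inv_mul _ (isUnit_cMat_det n hs hs0)) hS hST hTe

/-- [our object] **IR-3-ELL AT OPERATOR LEVEL, UPPER** (`M_B ⪯ 1` read on finitely supported fields; instance `A := Ĉ_n⁻¹`):
`Σ_{x,y∈T} Σ_{μν} (d^cφ)(x,μ)·Re K_{Ĉ_n⁻¹,μν}(x−y)·(d^cφ)(y,ν) ≤ Σ_{x,y∈T} φ(x)·Re K_{1∕Mid}(x−y)·φ(y)`. -/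
theorem form_grad_covInv_le (hd : 3 ≤ d + 1) {S T : Finset (X (d + 1))} {φ : X (d + 1) → ℝ} (hS : ∀ y ∉ S, φ y = 0) (hST : S ⊆ T)
    (hTe : ∀ μ, ∀ y ∈ S, y - e μ ∈ T) :
    ∑ x ∈ T, ∑ y ∈ T, ∑ μ, ∑ ν, (φ (x + e μ) - φ x) * (latticeKernel (fun p => (cMat n (reVec p))⁻¹ μ ν) (x - y)).re * (φ (y + e ν) - φ y) ≤
      ∑ x ∈ T, ∑ y ∈ T, φ x * (latticeKernel (fun p => (((midSym n (reVec p))⁻¹ : ℝ) : ℂ)) (x - y)).re * φ y :=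
  form_grad_le_of_leftInverse n hd (A := fun p => (cMat n (reVec p))⁻¹)
    (fun α β => by simp only [reVec_ofRealVec]; exact integrableOn_cMat_inv_apply n hd α β)
    (fun s hs hs0 => by rw [reVec_ofRealVec]; exact Matrix.nonsing_inv_mul _ (isUnit_cMat_det n hs hs0)) hS hST hTe

end Operator

end Summit.QuantumFields.BalabanUV.Beta.FP.ResidualModePlancherel

end
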